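import Literature.Analysis.SpecialFunctions.Hyp0F1
import Literature.Analysis.ValidatedNumerics.IntervalLogArctan

/-!
# `₀F₁(; b; −y)` and `ξ(α, x)` at INTERVAL arguments: the alternating enclosure of
# `Literature.Analysis.SpecialFunctions.Hyp0F1` carried in the fixed-point intervals `MI` (irrational `x`, e.g. multiples of `π`)

Sources. [DLMF §16.2 Eq. 16.2.1 (the series `₀F₁(−; b; z) = Σ_k z^k/(k!(b)_k)`), §10.16 Eq. 10.16.9 (`J_ν` through `₀F₁`), Eq. 10.16.1
(`J_{1/2}`: `ξ(½, x) = sin x/x`).] [Moore1979 = R. E. Moore, *Methods and Applications of Interval Analysis*, SIAM 1979, §3.2 Thm 3.1: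
an inclusion monotonic interval extension encloses the range — here for the rational recurrence of the partial sums.]

What is here (0 facts; the tree's `MI` engine `Literature.Analysis.ValidatedNumerics.IntervalLogArctan` and the real theory of
`Hyp0F1.lean` only): for `b = p/q` and an enclosure `Y ∋ y` at scale `S`, the recurrence `T_{k+1} = −(T_k·Y)·q/((k+1)(p + kq))`,
`A_{k+1} = A_k + T_k` on `MI` pairs (`hyp0F1StepI`, `hyp0F1IterI`), the result `hyp0F1I S p q Y m = hull A_m (A_m + T_m)` when the index
test `Y.hi·q ≤ S(m+1)(p + mq)` (i.e. `y ≤ (m+1)(b+m)`) passes, with soundness `mem_hyp0F1I` from `Hyp0F1.hyp0F1_mem_partialSums`;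
`xiI`/`mem_xiI` for `ξ(α, x) = ₀F₁(; α+1; −x²/4)` with `α + 1 = p/q`; kernel smoke test at an irrational argument:
`|ξ(½, π)| ≤ 10⁻¹²` from `MI.pi` (the true value is `sin π/π = 0`, `Hyp0F1.xi_half`).
-/

noncomputable section

open Finset
open Literature.Analysis.ValidatedNumerics.NumericsMP
open Literature.Analysis.SpecialFunctions.Hyp0F1

namespace Literature.Analysis.ValidatedNumerics.Hyp0F1Interval

/-! ### A between-lemma for `MI.hull` -/

/-- A real number lying between a member of `I` and a member of `J` (in either order) is a member of `hull I J`. [folklore] -/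
private theorem MI_mem_hull_of_between {S : ℕ} {u v x : ℝ} {I J : MI} (hu : MI.mem S u I) (hv : MI.mem S v J)
    (h1 : min u v ≤ x) (h2 : x ≤ max u v) : MI.mem S x (MI.hull I J) := by
  have hS0 : (0 : ℝ) ≤ S := by positivity
  simp only [MI.mem, MI.hull, Int.cast_min, Int.cast_max] at hu hv ⊢
  rcases le_total u v with huv | hvu
  · rw [min_eq_left huv] at h1; rw [max_eq_right huv] at h2
    constructor
    · exact (min_le_left _ _).trans (hu.1.trans (by nlinarith))
    · exact le_trans (by nlinarith) ((le_max_right _ _).trans' hv.2)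
  · rw [min_eq_right hvu] at h1; rw [max_eq_left hvu] at h2
    constructor
    · exact (min_le_right _ _).trans (hv.1.trans (by nlinarith))
    · exact le_trans (by nlinarith) ((le_max_left _ _).trans' hu.2)

/-! ### The interval recurrence -/

/-- One step: from `(T_k, A_k)` to `(T_{k+1}, A_{k+1})` for `b = p/q`:
`T_{k+1} = −(T_k·Y)·q / ((k+1)(p + kq))`, `A_{k+1} = A_k + T_k`. [folklore] -/
def hyp0F1StepI (S : ℕ) (p q : ℕ) (Y : MI) (k : ℕ) (TA : MI × MI) : MI × MI :=
  ((MI.neg (((MI.mul S TA.1 Y).mulInt (q : ℤ)).divNat ((k + 1) * (p + k * q)))), TA.2.add TA.1)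

/-- `m` steps from `(1, 0)`: returns `(T_m, A_m)` enclosing `(t_m, S_m)`. [folklore] -/
def hyp0F1IterI (S : ℕ) (p q : ℕ) (Y : MI) : ℕ → MI × MI
  | 0 => (MI.ofInt S 1, MI.ofInt S 0)
  | k + 1 => hyp0F1StepI S p q Y k (hyp0F1IterI S p q Y k)

/-- The enclosure of `₀F₁(; p/q; −y)` from `m` steps: `hull A_m (A_m + T_m)`, guarded by `0 ≤ Y.lo` and the index
condition `Y.hi·q ≤ S·(m+1)(p + mq)` (i.e. `y ≤ (m+1)(b+m)`); `none` if a guard fails. [folklore] -/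
def hyp0F1I (S : ℕ) (p q : ℕ) (Y : MI) (m : ℕ) : Option MI :=
  if 0 < p ∧ 0 < q ∧ 0 ≤ Y.lo ∧ Y.hi * (q : ℤ) ≤ (S : ℤ) * ((m + 1) * (p + m * q) : ℕ) then
    let TA := hyp0F1IterI S p q Y m
    some (MI.hull TA.2 (TA.2.add TA.1))
  else none

/-- Invariant of the iteration: `T_k ∋ t_k(b, −y)` and `A_k ∋ S_k`. [folklore] -/
private theorem mem_hyp0F1IterI {S : ℕ} (hS : 0 < S) {p q : ℕ} (hp : 0 < p) (hq : 0 < q) {y : ℝ} {Y : MI}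
    (hy : MI.mem S y Y) (k : ℕ) :
    MI.mem S (hyp0F1Term ((p : ℝ) / q) (-y) k) (hyp0F1IterI S p q Y k).1 ∧
      MI.mem S (partialSum ((p : ℝ) / q) y k) (hyp0F1IterI S p q Y k).2 := by
  have hb : (0 : ℝ) < (p : ℝ) / q := by positivity
  induction k with
  | zero =>
      simp only [hyp0F1IterI, hyp0F1Term_zero, partialSum, sum_range_zero]
      exact ⟨by simpa using MI.mem_ofInt S 1, by simpa using MI.mem_ofInt S 0⟩
  | succ k ih =>
      obtain ⟨ihT, ihA⟩ := ih
      simp only [hyp0F1IterI, hyp0F1StepI]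
      constructor
      · -- the term
        have hden : 0 < (k + 1) * (p + k * q) := by positivity
        have key := MI.mem_neg (MI.mem_divNat (MI.mem_mulInt (MI.mem_mul hS ihT hy) (q : ℤ)) hden)
        have e : hyp0F1Term ((p : ℝ) / q) (-y) (k + 1) =
            -(hyp0F1Term ((p : ℝ) / q) (-y) k * y * ((q : ℤ) : ℝ) / (((k + 1) * (p + k * q) : ℕ) : ℝ)) := by
          rw [hyp0F1Term_succ hb]
          have hq' : (q : ℝ) ≠ 0 := by positivity
          have hk : ((k : ℝ) + 1) ≠ 0 := by positivity
          have hpk : ((p : ℝ) / q + k) ≠ 0 := by positivity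
          push_cast
          field_simp
        rw [e]; exact key
      · -- the partial sum
        have e : partialSum ((p : ℝ) / q) y (k + 1) = partialSum ((p : ℝ) / q) y k + hyp0F1Term ((p : ℝ) / q) (-y) k := by
          unfold partialSum; rw [sum_range_succ]
        rw [e]; exact MI.mem_add ihA ihT

/-- **Soundness**: `hyp0F1I S p q Y m = some R` and `y ∈ Y` imply `₀F₁(; p/q; −y) ∈ R`. [cite: Moore1979, §3.2 Thm 3.1] -/
theorem mem_hyp0F1I {S : ℕ} (hS : 0 < S) {p q m : ℕ} {y : ℝ} {Y R : MI} (hy : MI.mem S y Y)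
    (h : hyp0F1I S p q Y m = some R) : MI.mem S (hyp0F1 ((p : ℝ) / q) (-y)) R := by
  unfold hyp0F1I at h
  split_ifs at h with hg
  obtain ⟨hp, hq, hYlo, hYhi⟩ := hg
  simp only [Option.some.injEq] at h
  subst h
  have hb : (0 : ℝ) < (p : ℝ) / q := by positivity
  have hSr : (0 : ℝ) < S := by exact_mod_cast hS
  -- `0 ≤ y` from `0 ≤ Y.lo`
  have hy0 : 0 ≤ y := by
    have h1 : (0 : ℝ) ≤ Y.lo := by exact_mod_cast hYlo
    nlinarith [hy.1]
  -- the index condition from `Y.hi`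
  have hm : y ≤ ((m : ℝ) + 1) * ((p : ℝ) / q + m) := by
    have h1 : y * S ≤ (Y.hi : ℝ) := hy.2
    have h2 : (Y.hi : ℝ) * q ≤ (S : ℝ) * (((m + 1) * (p + m * q) : ℕ) : ℝ) := by exact_mod_cast hYhi
    have hq' : (0 : ℝ) < q := by exact_mod_cast hq
    have h3 : y * S * q ≤ (S : ℝ) * (((m + 1) * (p + m * q) : ℕ) : ℝ) := by nlinarith
    have h4 : y * q ≤ (((m + 1) * (p + m * q) : ℕ) : ℝ) := by nlinarith
    rw [show ((m : ℝ) + 1) * ((p : ℝ) / q + m) = ((((m + 1) * (p + m * q) : ℕ) : ℝ)) / q by push_cast; field_simp]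
    rw [le_div_iff₀ hq']; exact h4
  obtain ⟨h1, h2⟩ := hyp0F1_mem_partialSums hb hy0 hm
  obtain ⟨hT, hA⟩ := mem_hyp0F1IterI hS hp hq hy m
  have hA1 : MI.mem S (partialSum ((p : ℝ) / q) y (m + 1)) ((hyp0F1IterI S p q Y m).2.add (hyp0F1IterI S p q Y m).1) := by
    have e : partialSum ((p : ℝ) / q) y (m + 1) = partialSum ((p : ℝ) / q) y m + hyp0F1Term ((p : ℝ) / q) (-y) m := by
      unfold partialSum; rw [sum_range_succ]
    rw [e]; exact MI.mem_add hA hT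
  exact MI_mem_hull_of_between hA hA1 h1 h2

/-! ### `ξ(α, x)` at an interval `X ∋ x` (`α + 1 = p/q`) -/

/-- Enclosure of `ξ(α, x) = ₀F₁(; α+1; −x²/4)` for `x ∈ X`, `α + 1 = p/q`, from `m` steps. [folklore] -/
def xiI (S : ℕ) (p q : ℕ) (X : MI) (m : ℕ) : Option MI := hyp0F1I S p q ((MI.sqr S X).divNat 4) m

/-- **Soundness of `xiI`.** [cite: Moore1979, §3.2 Thm 3.1] -/
theorem mem_xiI {S : ℕ} (hS : 0 < S) {p q m : ℕ} {α x : ℝ} {X R : MI} (hx : MI.mem S x X) (hα : α + 1 = (p : ℝ) / q)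
    (h : xiI S p q X m = some R) : MI.mem S (xi α x) R := by
  unfold xi
  rw [hα]
  have hy : MI.mem S (x ^ 2 / 4) ((MI.sqr S X).divNat 4) := by
    simpa using MI.mem_divNat (MI.mem_sqr hS hx) (show 0 < 4 by norm_num)
  exact mem_hyp0F1I hS hy h

/-! ### Kernel smoke test at an irrational argument: `ξ(½, π)` (true value `sin π/π = 0`) -/

/-- The checker result at scale `2^64`: `π` from `MI.pi` with 40 terms, `α + 1 = 3/2`, 16 steps. [folklore] -/
def xiHalfPi : Option MI :=
  (MI.pi (2 ^ 64) 40).bind fun P => xiI (2 ^ 64) 3 2 P 16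

/-- The bracket test `|R|·10¹² ≤ 2^64` (integers at scale `2^64`). [folklore] -/
private theorem xiHalfPi_check :
    (xiHalfPi.map fun R => decide (-(2 : ℤ) ^ 64 ≤ R.lo * 10 ^ 12 ∧ R.hi * 10 ^ 12 ≤ (2 : ℤ) ^ 64)) = some true := by
  decide +kernel

/-- **`|ξ(½, π)| ≤ 10⁻¹²`**, certified through the interval recurrence at the irrational argument `π` (consistent with the closed
form `ξ(½, x) = sin x/x`, which gives exactly `0` here). [cite: DLMF, §10.16 Eqs. 10.16.1, 10.16.9] -/
theorem abs_xi_half_pi_le : |xi (1 / 2) Real.pi| ≤ 1 / 10 ^ 12 := by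
  have hS : 0 < 2 ^ 64 := by norm_num
  have h := xiHalfPi_check
  unfold xiHalfPi at h
  cases hP : MI.pi (2 ^ 64) 40 with
  | none => rw [hP] at h; simp at h
  | some P =>
      rw [hP] at h
      simp only [Option.bind_some] at h
      cases hR : xiI (2 ^ 64) 3 2 P 16 with
      | none => rw [hR] at h; simp at h
      | some R =>
          rw [hR] at h
          simp only [Option.map_some, Option.some.injEq, decide_eq_true_eq] at h
          obtain ⟨hlo, hhi⟩ := h
          have hpi := MI.mem_pi (2 ^ 64) hP
          have hm := mem_xiI hS hpi (α := 1 / 2) (by norm_num) hR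
          obtain ⟨h1, h2⟩ := hm
          have hlo' : -(2 : ℝ) ^ 64 ≤ (R.lo : ℝ) * 10 ^ 12 := by exact_mod_cast hlo
          have hhi' : (R.hi : ℝ) * 10 ^ 12 ≤ (2 : ℝ) ^ 64 := by exact_mod_cast hhi
          push_cast at h1 h2
          rw [abs_le]
          constructor
          · rw [show -(1 / 10 ^ 12 : ℝ) = -(2 : ℝ) ^ 64 / (2 ^ 64 * 10 ^ 12) by norm_num]
            rw [div_le_iff₀ (by positivity)]; nlinarith
          · rw [show (1 / 10 ^ 12 : ℝ) = (2 : ℝ) ^ 64 / (2 ^ 64 * 10 ^ 12) by norm_num]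
            rw [le_div_iff₀ (by positivity)]; nlinarith

end Literature.Analysis.ValidatedNumerics.Hyp0F1Interval

end
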